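import Mathlib
import Literature.Barriers.ValiantsHypothesis.AlgebraicNaturalProofs
import Summits.ValiantsHypothesis.ValiantsHypothesis.Theorems.BarrierLeverSuccinctHittingSetsForVPShiftedSupport
import HarnessLib

/-!
# Crux `BarrierLever.SuccinctHittingSetsForVP` (stmt-ValiantsHypothesis-14610), line `registered` —
SPARSE ASSEMBLY (registered stub `stub_sparseGlue`)

**What is proved (it does NOT close the item).** The registered glue stub `stub_sparseGlue` of the
skeleton `Cruxes/SuccinctHittingSetsForVP/Lines/birth.lean`: GIVEN the statements of the three
neighbour stubs — Oliveira's product-sparsity lemma (`stub_prodSparsity`), the sparsity of a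
full-support Taylor shift (`stub_shiftSmallSupport`, FSV18 Lemma 32) and the existence of a
full-support circuit `f₀ ∈ SmallCircuits ℂ n 3` (`stub_fullSupport`) — for every sparsity exponent
`a`, for all `n ≥ 8a + 2`, the coefficient vectors of `SmallCircuits ℂ n 4` hit EVERY nonzero
polynomial in the `N = C(2n,n)` coefficient variables with at most `N^a` monomials (any degree, any
size): Forbes–Shpilka–Volk 2018 Thm. 9 / Cor. 34 transported to the tree's regime `d = n`.

Mechanism: if such a `D` vanished on `SmallCircuits ℂ n 4`, its Taylor shift to `coeff f₀` would have
only monomials of support `> t := 2an` (landed `card_support_gt_of_shift` with `b' = 3`, `b = 4`,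
budget `n³ + t(2n+2) + 1 ≤ n⁴` for `n ≥ 8a + 2`, `SparseGlue.size_budget`), while Lemma 32 gives a
monomial `m` of that very shift with `2^|supp m| ≤ |supp D| ≤ N^a ≤ (2^{2n})^a = 2^t`, i.e.
`|supp m| ≤ t` — contradiction. Axioms: `propext`, `Classical.choice`, `Quot.sound`.
References: [ForbesShpilkaVolk2018] Thm. 9, Lemma 32–33, Cor. 34.
-/

-- layout Summits/ValiantsHypothesis/ValiantsHypothesis forces the duplicated namespace component
set_option linter.dupNamespace false

namespace Summit.ValiantsHypothesis.ValiantsHypothesis.Theorems.BarrierLever.SuccinctHittingSetsForVP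

open Literature.Barriers.ValiantsHypothesis Literature.Computability.AlgebraicComplexity MvPolynomial

namespace SparseGlue

/-- The size budget of the shift: for `n ≥ 8a + 2`, `n³ + 2an(2n+2) + 1 ≤ n⁴`. [folklore] -/
theorem size_budget {a n : ℕ} (hn : 8 * a + 2 ≤ n) :
    n ^ 3 + 2 * a * n * (2 * n + 2) + 1 ≤ n ^ 4 := by
  have h1 : 1 ≤ n := by omega
  have hn3 : 1 ≤ n ^ 3 := Nat.one_le_pow _ _ h1
  have hmain : (8 * a + 2) * n ^ 3 ≤ n * n ^ 3 := Nat.mul_le_mul_right _ hn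
  have hlin : 4 * a * n ≤ 4 * a * n * n := Nat.le_mul_of_pos_right _ h1
  have hsq : 8 * a * (n * n) ≤ 8 * a * (n * n) * n := Nat.le_mul_of_pos_right _ h1
  calc n ^ 3 + 2 * a * n * (2 * n + 2) + 1
      = n ^ 3 + (4 * a * n * n + 4 * a * n) + 1 := by ring
    _ ≤ n ^ 3 + (4 * a * n * n + 4 * a * n * n) + n ^ 3 := by gcongr
    _ = n ^ 3 + 8 * a * (n * n) + n ^ 3 := by ring
    _ ≤ n ^ 3 + 8 * a * (n * n) * n + n ^ 3 := by gcongr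
    _ = (8 * a + 2) * n ^ 3 := by ring
    _ ≤ n * n ^ 3 := hmain
    _ = n ^ 4 := by ring

/-- The sparsity budget: `C(2n,n)^a ≤ 2^(2an)`. [folklore] -/
theorem choose_pow_le {a n : ℕ} : Nat.choose (2 * n) n ^ a ≤ 2 ^ (2 * a * n) :=
  calc Nat.choose (2 * n) n ^ a ≤ (2 ^ (2 * n)) ^ a :=
        Nat.pow_le_pow_left (Nat.choose_le_two_pow (2 * n) n) a
    _ = 2 ^ (2 * a * n) := by rw [← pow_mul, Nat.mul_right_comm]

end SparseGlue

/-- **Registered stub `stub_sparseGlue`** (crux stmt-ValiantsHypothesis-14610, line `registered`;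
sparse assembly): from the product-sparsity lemma, the sparsity of full-support shifts and a
full-support circuit in `SmallCircuits ℂ n 3`, for every sparsity exponent `a`, eventually in `n`,
`SmallCircuits ℂ n 4` is a succinct hitting set for all polynomials in the `C(2n,n)` coefficient
variables with at most `C(2n,n)^a` monomials. [cite: ForbesShpilkaVolk2018, Thm. 9 and Cor. 34] -/
theorem stub_sparseGlue :
    (∀ (ι : Type) (S : Finset ι) (a : ι → ℂ), (∀ i ∈ S, a i ≠ 0) →
      ∀ H : MvPolynomial ι ℂ, H ≠ 0 →
        2 ^ S.card ≤ ((∏ i ∈ S, (X i - C (a i))) * H).support.card) →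
    ((∀ (ι : Type) (S : Finset ι) (a : ι → ℂ), (∀ i ∈ S, a i ≠ 0) →
        ∀ H : MvPolynomial ι ℂ, H ≠ 0 →
          2 ^ S.card ≤ ((∏ i ∈ S, (X i - C (a i))) * H).support.card) →
      ∀ (ι : Type) (a : ι → ℂ), (∀ i, a i ≠ 0) →
        ∀ D : MvPolynomial ι ℂ, D ≠ 0 →
          ∃ m ∈ (aeval (fun i => C (a i) + X i) D).support, 2 ^ m.support.card ≤ D.support.card) →
    (∀ n : ℕ, 2 ≤ n → ∃ f₀ ∈ SmallCircuits ℂ n 3,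
      ∀ m : degLEMonomials n, MvPolynomial.coeff (m : Fin n →₀ ℕ) f₀ ≠ 0) →
    ∀ a : ℕ, ∃ n₀ : ℕ, ∀ n : ℕ, n₀ ≤ n →
      IsSuccinctHittingSet (degLEMonomials n) (SmallCircuits ℂ n 4)
        {D | D.support.card ≤ Nat.choose (2 * n) n ^ a} := by
  intro hP1 hP2 hP3 a
  refine ⟨8 * a + 2, fun n hn => ?_⟩
  intro D hD hD0
  have hDa : D.support.card ≤ Nat.choose (2 * n) n ^ a := hD
  obtain ⟨f₀, hf₀, hfull⟩ := hP3 n (by omega)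
  by_contra hcon
  push Not at hcon
  obtain ⟨m, hm, hmcard⟩ :=
    hP2 hP1 (degLEMonomials n) (fun μ => coeff (μ : Fin n →₀ ℕ) f₀) hfull D hD0
  have hlt : 2 * a * n < m.support.card :=
    card_support_gt_of_shift (SparseGlue.size_budget hn) hcon hf₀ hm
  have hle : 2 ^ m.support.card ≤ 2 ^ (2 * a * n) :=
    hmcard.trans (hDa.trans SparseGlue.choose_pow_le)
  have hle' : m.support.card ≤ 2 * a * n := (Nat.pow_le_pow_iff_right (by norm_num)).mp hle
  omega

end Summit.ValiantsHypothesis.ValiantsHypothesis.Theorems.BarrierLever.SuccinctHittingSetsForVP
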